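import Literature.Probability.RandomPlanarGeometry.HexSAWBrickWallStripFugacityWidthOneContactEntropyCurvature
import Mathlib.Analysis.Calculus.InverseFunctionTheorem.FDeriv
import HarnessLib

/-!
# The susceptibility matrix of the two-wall strip: the contact densities are C¹ in the log-fugacities, with derivative the inverse entropy Hessian

Child module of `…ContactEntropyCurvature` (#723: the Hessian form `Q_{a,a'}` of `−s`, positive definite on the open triangle).  The LOG-TILT MAP
`Θ(a,a') = (log Y(a,a'), log Y(a',a))` (inverse equation of state in logarithmic coordinates) sends the open density triangle `T` onto `ℝ²`,
with inverse the DENSITY MAP `g(A,B) = (b(e^A,e^B), b(e^B,e^A))` (`eosY_contactB`, `contactB_eosY`).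
* §1 `Θ` is strictly differentiable on `T` with derivative the symmetric matrix
  `M_{a,a'} = [[4/ρ+8/P+2/Q−1/a, 4/ρ+4/P+4/Q], [4/ρ+4/P+4/Q, 4/ρ+2/P+8/Q−1/a']]` (`= −Hess s`, whose quadratic form is #723's `Q`);
  `M` is injective (positive definite), hence a linear isomorphism of `ℝ²`, `det M > 0`;
* §2 ★★★★ **THE DENSITY MAP IS STRICTLY DIFFERENTIABLE with derivative `M⁻¹`** at every `(A,B) ∈ ℝ²` (inverse function theorem in the form
  `HasStrictFDerivAt.of_local_left_inverse`: `g` is continuous and `Θ ∘ g = id`) — the SUSCEPTIBILITY MATRIX `∂(b,b')/∂(log y, log z) = M⁻¹`,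
  i.e. the free energy `log μ₁(e^A,e^B)` (whose gradient is `g`) is `C²` with Hessian `M⁻¹`;
* §3 ★★★ the entries: `∂b/∂log y = M₂₂/det > 0`, `∂b'/∂log z = M₁₁/det > 0`, and the MAXWELL cross term
  `∂b/∂log z = ∂b'/∂log y = −M₁₂/det < 0` — THE WALLS COMPETE: making one wall more attractive strictly decreases the contact density at the other
  (the qualitative monotonicity is the tree's `contactB_strictAnti_right`; here with the explicit rate);
* §4 ★★★ the free energy `log μ₁(e^A,e^B)` is `C²`: its `A`-derivative `b(e^A,e^B)` (tree `hasDerivAt_log_stripMuY₂_exp`) has `A`- and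
  `B`-derivatives `M₂₂/det` and `−M₁₂/det`.

## Sources
DemboZeitouni2010 §2.2 (Legendre duality: the Hessians of `Λ` and `Λ*` are inverse to each other); JansevanRensburg2000 §3.3 (1st ed., OUP 2000:
differentiability of the free energy / density function).  Mathlib's inverse function theorem (`HasStrictFDerivAt.of_local_left_inverse`).
Nothing quoted AS PRINTED; statements are this lineage's.
-/

noncomputable section

open Filter Topology Finset Literature.Probability.LatticeModels Literature.Probability.Percolation SimpleGraph

namespace Literature.Probability.RandomPlanarGeometry.SAW.HexBW

open WidthOneYZ Real

/-! ## §1 The log-tilt map and its derivative -/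

/-- The derivative of the first log-tilt `(a,a') ↦ log Y(a,a') = 2 log P + log Q − log 2a − 2 log ρ` written with explicit logarithms:
a strict Fréchet derivative with the linear form `(4/ρ+8/P+2/Q−1/a)·da + (4/ρ+4/P+4/Q)·da'`.
[cite: DemboZeitouni2010, §2.2 (lane plumbing)] -/
theorem hasStrictFDerivAt_logTilt₁ {a a' : ℝ} (h1 : a + a' < 1 / 2) (h2 : 1 < 4 * a + 2 * a') (h3 : 1 < 2 * a + 4 * a') :
    HasStrictFDerivAt (fun p : ℝ × ℝ => 2 * Real.log (4 * p.1 + 2 * p.2 - 1) + Real.log (2 * p.1 + 4 * p.2 - 1)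
        - Real.log (2 * p.1) - 2 * Real.log (1 - 2 * p.1 - 2 * p.2))
      ((4 / (1 - 2 * a - 2 * a') + 8 / (4 * a + 2 * a' - 1) + 2 / (2 * a + 4 * a' - 1) - 1 / a) • ContinuousLinearMap.fst ℝ ℝ ℝ +
        (4 / (1 - 2 * a - 2 * a') + 4 / (4 * a + 2 * a' - 1) + 4 / (2 * a + 4 * a' - 1)) • ContinuousLinearMap.snd ℝ ℝ ℝ) (a, a') := by
  have ha : 0 < a := by linarith
  have hρ : (0 : ℝ) < 1 - 2 * a - 2 * a' := by linarith
  have hP : (0 : ℝ) < 4 * a + 2 * a' - 1 := by linarith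
  have hQ : (0 : ℝ) < 2 * a + 4 * a' - 1 := by linarith
  have dfst := hasStrictFDerivAt_fst (𝕜 := ℝ) (E := ℝ) (F := ℝ) (p := (a, a'))
  have dsnd := hasStrictFDerivAt_snd (𝕜 := ℝ) (E := ℝ) (F := ℝ) (p := (a, a'))
  have dP : HasStrictFDerivAt (fun p : ℝ × ℝ => 4 * p.1 + 2 * p.2 - 1)
      ((4 : ℝ) • ContinuousLinearMap.fst ℝ ℝ ℝ + (2 : ℝ) • ContinuousLinearMap.snd ℝ ℝ ℝ) (a, a') :=
    ((dfst.const_mul (4 : ℝ)).add (dsnd.const_mul (2 : ℝ))).sub_const 1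
  have dQ : HasStrictFDerivAt (fun p : ℝ × ℝ => 2 * p.1 + 4 * p.2 - 1)
      ((2 : ℝ) • ContinuousLinearMap.fst ℝ ℝ ℝ + (4 : ℝ) • ContinuousLinearMap.snd ℝ ℝ ℝ) (a, a') :=
    ((dfst.const_mul (2 : ℝ)).add (dsnd.const_mul (4 : ℝ))).sub_const 1
  have dA : HasStrictFDerivAt (fun p : ℝ × ℝ => 2 * p.1) ((2 : ℝ) • ContinuousLinearMap.fst ℝ ℝ ℝ) (a, a') :=
    dfst.const_mul (2 : ℝ)
  have dρ : HasStrictFDerivAt (fun p : ℝ × ℝ => 1 - 2 * p.1 - 2 * p.2)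
      (-((2 : ℝ) • ContinuousLinearMap.fst ℝ ℝ ℝ) - (2 : ℝ) • ContinuousLinearMap.snd ℝ ℝ ℝ) (a, a') :=
    ((dfst.const_mul (2 : ℝ)).const_sub 1).sub (dsnd.const_mul (2 : ℝ))
  have lP := (dP.log hP.ne').const_mul (2 : ℝ)
  have lQ := dQ.log hQ.ne'
  have lA := dA.log (by positivity : (2 : ℝ) * a ≠ 0)
  have lρ := (dρ.log hρ.ne').const_mul (2 : ℝ)
  have d := ((lP.add lQ).sub lA).sub lρ
  refine d.congr_fderiv ?_
  refine ContinuousLinearMap.ext fun v => ?_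
  obtain ⟨v₁, v₂⟩ := v
  simp [smul_eq_mul]
  field_simp
  ring

/-- The same for the second log-tilt `(a,a') ↦ log Y(a',a) = 2 log Q + log P − log 2a' − 2 log ρ`: linear form
`(4/ρ+4/P+4/Q)·da + (4/ρ+2/P+8/Q−1/a')·da'`. [cite: DemboZeitouni2010, §2.2 (lane plumbing)] -/
theorem hasStrictFDerivAt_logTilt₂ {a a' : ℝ} (h1 : a + a' < 1 / 2) (h2 : 1 < 4 * a + 2 * a') (h3 : 1 < 2 * a + 4 * a') :
    HasStrictFDerivAt (fun p : ℝ × ℝ => 2 * Real.log (2 * p.1 + 4 * p.2 - 1) + Real.log (4 * p.1 + 2 * p.2 - 1)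
        - Real.log (2 * p.2) - 2 * Real.log (1 - 2 * p.1 - 2 * p.2))
      ((4 / (1 - 2 * a - 2 * a') + 4 / (4 * a + 2 * a' - 1) + 4 / (2 * a + 4 * a' - 1)) • ContinuousLinearMap.fst ℝ ℝ ℝ +
        (4 / (1 - 2 * a - 2 * a') + 2 / (4 * a + 2 * a' - 1) + 8 / (2 * a + 4 * a' - 1) - 1 / a') • ContinuousLinearMap.snd ℝ ℝ ℝ)
      (a, a') := by
  have ha' : 0 < a' := by linarith
  have hρ : (0 : ℝ) < 1 - 2 * a - 2 * a' := by linarith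
  have hP : (0 : ℝ) < 4 * a + 2 * a' - 1 := by linarith
  have hQ : (0 : ℝ) < 2 * a + 4 * a' - 1 := by linarith
  have dfst := hasStrictFDerivAt_fst (𝕜 := ℝ) (E := ℝ) (F := ℝ) (p := (a, a'))
  have dsnd := hasStrictFDerivAt_snd (𝕜 := ℝ) (E := ℝ) (F := ℝ) (p := (a, a'))
  have dP : HasStrictFDerivAt (fun p : ℝ × ℝ => 4 * p.1 + 2 * p.2 - 1)
      ((4 : ℝ) • ContinuousLinearMap.fst ℝ ℝ ℝ + (2 : ℝ) • ContinuousLinearMap.snd ℝ ℝ ℝ) (a, a') :=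
    ((dfst.const_mul (4 : ℝ)).add (dsnd.const_mul (2 : ℝ))).sub_const 1
  have dQ : HasStrictFDerivAt (fun p : ℝ × ℝ => 2 * p.1 + 4 * p.2 - 1)
      ((2 : ℝ) • ContinuousLinearMap.fst ℝ ℝ ℝ + (4 : ℝ) • ContinuousLinearMap.snd ℝ ℝ ℝ) (a, a') :=
    ((dfst.const_mul (2 : ℝ)).add (dsnd.const_mul (4 : ℝ))).sub_const 1
  have dA : HasStrictFDerivAt (fun p : ℝ × ℝ => 2 * p.2) ((2 : ℝ) • ContinuousLinearMap.snd ℝ ℝ ℝ) (a, a') :=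
    dsnd.const_mul (2 : ℝ)
  have dρ : HasStrictFDerivAt (fun p : ℝ × ℝ => 1 - 2 * p.1 - 2 * p.2)
      (-((2 : ℝ) • ContinuousLinearMap.fst ℝ ℝ ℝ) - (2 : ℝ) • ContinuousLinearMap.snd ℝ ℝ ℝ) (a, a') :=
    ((dfst.const_mul (2 : ℝ)).const_sub 1).sub (dsnd.const_mul (2 : ℝ))
  have lQ := (dQ.log hQ.ne').const_mul (2 : ℝ)
  have lP := dP.log hP.ne'
  have lA := dA.log (by positivity : (2 : ℝ) * a' ≠ 0)
  have lρ := (dρ.log hρ.ne').const_mul (2 : ℝ)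
  have d := ((lQ.add lP).sub lA).sub lρ
  refine d.congr_fderiv ?_
  refine ContinuousLinearMap.ext fun v => ?_
  obtain ⟨v₁, v₂⟩ := v
  simp [smul_eq_mul]
  field_simp
  ring

/-- On the open triangle, `log Y(a,a') = 2 log P + log Q − log 2a − 2 log ρ`. [cite: BeatonBousquetMelouDeGierDuminilCopinGuttmann2014, §3.2 Proposition 6 (arXiv v5 p. 10; lane plumbing on the tree's `eosY`)] -/
theorem log_eosY_eq {a a' : ℝ} (h1 : a + a' < 1 / 2) (h2 : 1 < 4 * a + 2 * a') (h3 : 1 < 2 * a + 4 * a') :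
    Real.log (eosY a a') = 2 * Real.log (4 * a + 2 * a' - 1) + Real.log (2 * a + 4 * a' - 1) - Real.log (2 * a)
      - 2 * Real.log (1 - 2 * a - 2 * a') := by
  have ha : 0 < a := by linarith
  have hρ : (0 : ℝ) < 1 - 2 * a - 2 * a' := by linarith
  have hP : (0 : ℝ) < 4 * a + 2 * a' - 1 := by linarith
  have hQ : (0 : ℝ) < 2 * a + 4 * a' - 1 := by linarith
  have eY : eosY a a' = (4 * a + 2 * a' - 1) ^ 2 * (2 * a + 4 * a' - 1) / ((2 * a) * (1 - 2 * a - 2 * a') ^ 2) := by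
    unfold eosY; ring
  rw [eY, Real.log_div (by positivity) (by positivity), Real.log_mul (by positivity) (by positivity), Real.log_pow,
    Real.log_mul (by positivity) (by positivity), Real.log_pow]
  push_cast; ring

/-- On the open triangle, `log Y(a',a) = 2 log Q + log P − log 2a' − 2 log ρ` (the mirror tilt, written in the `(a,a')` frame).
[cite: BeatonBousquetMelouDeGierDuminilCopinGuttmann2014, §3.2 Proposition 6 (arXiv v5 p. 10; lane plumbing)] -/
theorem log_eosY_swap_eq {a a' : ℝ} (h1 : a + a' < 1 / 2) (h2 : 1 < 4 * a + 2 * a') (h3 : 1 < 2 * a + 4 * a') :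
    Real.log (eosY a' a) = 2 * Real.log (2 * a + 4 * a' - 1) + Real.log (4 * a + 2 * a' - 1) - Real.log (2 * a')
      - 2 * Real.log (1 - 2 * a - 2 * a') := by
  rw [log_eosY_eq (by linarith) (by linarith) (by linarith)]
  have e1 : 4 * a' + 2 * a - 1 = 2 * a + 4 * a' - 1 := by ring
  have e2 : 2 * a' + 4 * a - 1 = 4 * a + 2 * a' - 1 := by ring
  have e3 : 1 - 2 * a' - 2 * a = 1 - 2 * a - 2 * a' := by ring
  rw [e1, e2, e3]

/-- ★★ **THE LOG-TILT MAP IS STRICTLY DIFFERENTIABLE WITH DERIVATIVE `M = −Hess s`**: at `(a,a')` in the open triangle,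
`Θ(p) = (log Y(p), log Y(p.swap))` has the strict Fréchet derivative `(L₁, L₂)` with the two linear forms of `hasStrictFDerivAt_logTilt₁/₂`
(the symmetric matrix `[[4/ρ+8/P+2/Q−1/a, 4/ρ+4/P+4/Q],[4/ρ+4/P+4/Q, 4/ρ+2/P+8/Q−1/a']]`).
[cite: DemboZeitouni2010, §2.2 (the dual parameter map; lane statement)] -/
theorem hasStrictFDerivAt_logTilt {a a' : ℝ} (h1 : a + a' < 1 / 2) (h2 : 1 < 4 * a + 2 * a') (h3 : 1 < 2 * a + 4 * a') :
    HasStrictFDerivAt (fun p : ℝ × ℝ => (Real.log (eosY p.1 p.2), Real.log (eosY p.2 p.1)))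
      ((((4 / (1 - 2 * a - 2 * a') + 8 / (4 * a + 2 * a' - 1) + 2 / (2 * a + 4 * a' - 1) - 1 / a) •
          ContinuousLinearMap.fst ℝ ℝ ℝ +
        (4 / (1 - 2 * a - 2 * a') + 4 / (4 * a + 2 * a' - 1) + 4 / (2 * a + 4 * a' - 1)) • ContinuousLinearMap.snd ℝ ℝ ℝ)).prod
        ((4 / (1 - 2 * a - 2 * a') + 4 / (4 * a + 2 * a' - 1) + 4 / (2 * a + 4 * a' - 1)) • ContinuousLinearMap.fst ℝ ℝ ℝ +
        (4 / (1 - 2 * a - 2 * a') + 2 / (4 * a + 2 * a' - 1) + 8 / (2 * a + 4 * a' - 1) - 1 / a') • ContinuousLinearMap.snd ℝ ℝ ℝ))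
      (a, a') := by
  have d := (hasStrictFDerivAt_logTilt₁ h1 h2 h3).prodMk (hasStrictFDerivAt_logTilt₂ h1 h2 h3)
  refine d.congr_of_eventuallyEq ?_
  -- near `(a,a')` the point stays in the open triangle, where the explicit logarithms are `log Y`
  have hmem : ∀ᶠ p : ℝ × ℝ in 𝓝 (a, a'), p.1 + p.2 < 1 / 2 ∧ 1 < 4 * p.1 + 2 * p.2 ∧ 1 < 2 * p.1 + 4 * p.2 :=
    isOpen_densityTriangle.mem_nhds ⟨h1, h2, h3⟩
  filter_upwards [hmem] with p hp
  obtain ⟨k1, k2, k3⟩ := hp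
  rw [log_eosY_eq k1 k2 k3, log_eosY_swap_eq k1 k2 k3]

/-- ★★ **`M` IS INJECTIVE** (its quadratic form is #723's positive definite `Q`): if `M v = 0` then `v = 0`.
[cite: DemboZeitouni2010, §2.2 (lane statement)] -/
theorem logTiltDeriv_injective {a a' : ℝ} (h1 : a + a' < 1 / 2) (h2 : 1 < 4 * a + 2 * a') (h3 : 1 < 2 * a + 4 * a') :
    Function.Injective
      ((((4 / (1 - 2 * a - 2 * a') + 8 / (4 * a + 2 * a' - 1) + 2 / (2 * a + 4 * a' - 1) - 1 / a) •
          ContinuousLinearMap.fst ℝ ℝ ℝ +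
        (4 / (1 - 2 * a - 2 * a') + 4 / (4 * a + 2 * a' - 1) + 4 / (2 * a + 4 * a' - 1)) • ContinuousLinearMap.snd ℝ ℝ ℝ)).prod
        ((4 / (1 - 2 * a - 2 * a') + 4 / (4 * a + 2 * a' - 1) + 4 / (2 * a + 4 * a' - 1)) • ContinuousLinearMap.fst ℝ ℝ ℝ +
        (4 / (1 - 2 * a - 2 * a') + 2 / (4 * a + 2 * a' - 1) + 8 / (2 * a + 4 * a' - 1) - 1 / a') • ContinuousLinearMap.snd ℝ ℝ ℝ) :
        ℝ × ℝ → ℝ × ℝ) := by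
  -- injective linear map: kernel trivial
  intro v w hvw
  have key : ∀ u : ℝ × ℝ,
      ((((4 / (1 - 2 * a - 2 * a') + 8 / (4 * a + 2 * a' - 1) + 2 / (2 * a + 4 * a' - 1) - 1 / a) •
          ContinuousLinearMap.fst ℝ ℝ ℝ +
        (4 / (1 - 2 * a - 2 * a') + 4 / (4 * a + 2 * a' - 1) + 4 / (2 * a + 4 * a' - 1)) • ContinuousLinearMap.snd ℝ ℝ ℝ)).prod
        ((4 / (1 - 2 * a - 2 * a') + 4 / (4 * a + 2 * a' - 1) + 4 / (2 * a + 4 * a' - 1)) • ContinuousLinearMap.fst ℝ ℝ ℝ +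
        (4 / (1 - 2 * a - 2 * a') + 2 / (4 * a + 2 * a' - 1) + 8 / (2 * a + 4 * a' - 1) - 1 / a') • ContinuousLinearMap.snd ℝ ℝ ℝ))
        u = 0 → u = 0 := by
    intro u hu
    obtain ⟨u₁, u₂⟩ := u
    have c1 : (4 / (1 - 2 * a - 2 * a') + 8 / (4 * a + 2 * a' - 1) + 2 / (2 * a + 4 * a' - 1) - 1 / a) * u₁ +
        (4 / (1 - 2 * a - 2 * a') + 4 / (4 * a + 2 * a' - 1) + 4 / (2 * a + 4 * a' - 1)) * u₂ = 0 := congrArg Prod.fst hu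
    have c2 : (4 / (1 - 2 * a - 2 * a') + 4 / (4 * a + 2 * a' - 1) + 4 / (2 * a + 4 * a' - 1)) * u₁ +
        (4 / (1 - 2 * a - 2 * a') + 2 / (4 * a + 2 * a' - 1) + 8 / (2 * a + 4 * a' - 1) - 1 / a') * u₂ = 0 := congrArg Prod.snd hu
    by_contra hne
    have hpos := curvatureForm_pos h1 h2 h3 (v₁ := u₁) (v₂ := u₂) hne
    -- the quadratic form is `u₁·(Mu)₁ + u₂·(Mu)₂`
    have e : 4 * (u₁ + u₂) ^ 2 / (1 - 2 * a - 2 * a') + 2 * (2 * u₁ + u₂) ^ 2 / (4 * a + 2 * a' - 1)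
        + 2 * (u₁ + 2 * u₂) ^ 2 / (2 * a + 4 * a' - 1) - u₁ ^ 2 / a - u₂ ^ 2 / a' =
        u₁ * ((4 / (1 - 2 * a - 2 * a') + 8 / (4 * a + 2 * a' - 1) + 2 / (2 * a + 4 * a' - 1) - 1 / a) * u₁ +
          (4 / (1 - 2 * a - 2 * a') + 4 / (4 * a + 2 * a' - 1) + 4 / (2 * a + 4 * a' - 1)) * u₂) +
        u₂ * ((4 / (1 - 2 * a - 2 * a') + 4 / (4 * a + 2 * a' - 1) + 4 / (2 * a + 4 * a' - 1)) * u₁ +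
          (4 / (1 - 2 * a - 2 * a') + 2 / (4 * a + 2 * a' - 1) + 8 / (2 * a + 4 * a' - 1) - 1 / a') * u₂) := by ring
    rw [e, c1, c2, mul_zero, mul_zero, add_zero] at hpos
    exact lt_irrefl _ hpos
  have hsub := key (v - w) (by rw [map_sub, hvw, sub_self])
  exact sub_eq_zero.1 hsub

/-! ## §2 The density map is strictly differentiable: the susceptibility matrix `M⁻¹` -/

/-- The density map `g(A,B) = (b(e^A,e^B), b(e^B,e^A))` is continuous. [cite: DemboZeitouni2010, §2.2 (lane plumbing)] -/
theorem continuousAt_densityMap (A B : ℝ) :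
    ContinuousAt (fun q : ℝ × ℝ => ((contactB (Real.exp q.1) (Real.exp q.2), contactB (Real.exp q.2) (Real.exp q.1)) : ℝ × ℝ))
      (A, B) := by
  have he : ContinuousAt (fun q : ℝ × ℝ => ((Real.exp q.1, Real.exp q.2) : ℝ × ℝ)) (A, B) := by fun_prop
  have he' : ContinuousAt (fun q : ℝ × ℝ => ((Real.exp q.2, Real.exp q.1) : ℝ × ℝ)) (A, B) := by fun_prop
  have h1 := ContinuousAt.comp (f := fun q : ℝ × ℝ => ((Real.exp q.1, Real.exp q.2) : ℝ × ℝ))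
    (g := fun p : ℝ × ℝ => contactB p.1 p.2) (continuousAt_contactB₂ (Real.exp_pos A) (Real.exp_pos B)) he
  have h2 := ContinuousAt.comp (f := fun q : ℝ × ℝ => ((Real.exp q.2, Real.exp q.1) : ℝ × ℝ))
    (g := fun p : ℝ × ℝ => contactB p.1 p.2) (continuousAt_contactB₂ (Real.exp_pos B) (Real.exp_pos A)) he'
  exact h1.prodMk h2

/-- The log-tilt map inverts the density map: `Θ(g(A,B)) = (A,B)` for all `(A,B)`. [cite: DemboZeitouni2010, §2.2 (lane plumbing)] -/
theorem logTilt_densityMap (q : ℝ × ℝ) :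
    ((Real.log (eosY (contactB (Real.exp q.1) (Real.exp q.2)) (contactB (Real.exp q.2) (Real.exp q.1))),
      Real.log (eosY (contactB (Real.exp q.2) (Real.exp q.1)) (contactB (Real.exp q.1) (Real.exp q.2)))) : ℝ × ℝ) = q := by
  obtain ⟨eY, eZ⟩ := eosY_contactB (Real.exp_pos q.1) (Real.exp_pos q.2)
  rw [eY, eZ, Real.log_exp, Real.log_exp]

/-- ★★★★ **THE SUSCEPTIBILITY MATRIX: THE DENSITY MAP IS STRICTLY DIFFERENTIABLE WITH DERIVATIVE `M⁻¹`**: for every `(A,B) ∈ ℝ²`, with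
`(b,b') = (b(e^A,e^B), b(e^B,e^A))` the typical density pair and `M` the symmetric positive definite matrix
`[[4/ρ+8/P+2/Q−1/b, 4/ρ+4/P+4/Q],[4/ρ+4/P+4/Q, 4/ρ+2/P+8/Q−1/b']]` at `(b,b')` (`= −Hess s`, the entropy Hessian of #723), there is a
continuous linear automorphism `E` of `ℝ²` acting as `M` such that the density map `(A,B) ↦ (b(e^A,e^B), b(e^B,e^A))` has the STRICT
FRÉCHET DERIVATIVE `E⁻¹` at `(A,B)`.  Equivalently: the free energy `F(A,B) = log μ₁(e^A,e^B)`, whose gradient is the density map, is `C²`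
near every point with Hessian `M⁻¹` — the Hessians of the free energy and of the rate function are mutually inverse (Legendre duality).
Proof: inverse function theorem (`HasStrictFDerivAt.of_local_left_inverse`) for the log-tilt map `Θ`, a left inverse of the continuous
density map, strictly differentiable with the injective derivative `M`.
[cite: DemboZeitouni2010, §2.2 (Λ and Λ* are Legendre conjugate; lane statement: their Hessians are inverse); JansevanRensburg2000, §3.3 (1st ed.: differentiability of free energy and density function)] -/
theorem hasStrictFDerivAt_densityMap (A B : ℝ) :
    ∃ E : (ℝ × ℝ) ≃L[ℝ] (ℝ × ℝ),
      (∀ v : ℝ × ℝ, E v =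
        ((4 / (1 - 2 * contactB (Real.exp A) (Real.exp B) - 2 * contactB (Real.exp B) (Real.exp A))
            + 8 / (4 * contactB (Real.exp A) (Real.exp B) + 2 * contactB (Real.exp B) (Real.exp A) - 1)
            + 2 / (2 * contactB (Real.exp A) (Real.exp B) + 4 * contactB (Real.exp B) (Real.exp A) - 1)
            - 1 / contactB (Real.exp A) (Real.exp B)) * v.1 +
          (4 / (1 - 2 * contactB (Real.exp A) (Real.exp B) - 2 * contactB (Real.exp B) (Real.exp A))
            + 4 / (4 * contactB (Real.exp A) (Real.exp B) + 2 * contactB (Real.exp B) (Real.exp A) - 1)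
            + 4 / (2 * contactB (Real.exp A) (Real.exp B) + 4 * contactB (Real.exp B) (Real.exp A) - 1)) * v.2,
         (4 / (1 - 2 * contactB (Real.exp A) (Real.exp B) - 2 * contactB (Real.exp B) (Real.exp A))
            + 4 / (4 * contactB (Real.exp A) (Real.exp B) + 2 * contactB (Real.exp B) (Real.exp A) - 1)
            + 4 / (2 * contactB (Real.exp A) (Real.exp B) + 4 * contactB (Real.exp B) (Real.exp A) - 1)) * v.1 +
          (4 / (1 - 2 * contactB (Real.exp A) (Real.exp B) - 2 * contactB (Real.exp B) (Real.exp A))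
            + 2 / (4 * contactB (Real.exp A) (Real.exp B) + 2 * contactB (Real.exp B) (Real.exp A) - 1)
            + 8 / (2 * contactB (Real.exp A) (Real.exp B) + 4 * contactB (Real.exp B) (Real.exp A) - 1)
            - 1 / contactB (Real.exp B) (Real.exp A)) * v.2)) ∧
      HasStrictFDerivAt
        (fun q : ℝ × ℝ => ((contactB (Real.exp q.1) (Real.exp q.2), contactB (Real.exp q.2) (Real.exp q.1)) : ℝ × ℝ))
        (E.symm : (ℝ × ℝ) →L[ℝ] (ℝ × ℝ)) (A, B) := by
  obtain ⟨t1, t2, t3⟩ := contactB_mem_triangle (Real.exp_pos A) (Real.exp_pos B)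
  set b := contactB (Real.exp A) (Real.exp B) with hb
  set b' := contactB (Real.exp B) (Real.exp A) with hb'
  -- the derivative of the log-tilt map at `(b,b')`
  obtain ⟨M, hM⟩ : ∃ M : (ℝ × ℝ) →L[ℝ] (ℝ × ℝ), M =
    (((4 / (1 - 2 * b - 2 * b') + 8 / (4 * b + 2 * b' - 1) + 2 / (2 * b + 4 * b' - 1) - 1 / b) • ContinuousLinearMap.fst ℝ ℝ ℝ +
        (4 / (1 - 2 * b - 2 * b') + 4 / (4 * b + 2 * b' - 1) + 4 / (2 * b + 4 * b' - 1)) • ContinuousLinearMap.snd ℝ ℝ ℝ)).prod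
      ((4 / (1 - 2 * b - 2 * b') + 4 / (4 * b + 2 * b' - 1) + 4 / (2 * b + 4 * b' - 1)) • ContinuousLinearMap.fst ℝ ℝ ℝ +
        (4 / (1 - 2 * b - 2 * b') + 2 / (4 * b + 2 * b' - 1) + 8 / (2 * b + 4 * b' - 1) - 1 / b') • ContinuousLinearMap.snd ℝ ℝ ℝ) :=
    ⟨_, rfl⟩
  have hinj : Function.Injective M := by rw [hM]; exact logTiltDeriv_injective t1 t2 t3
  have hker : LinearMap.ker (M : (ℝ × ℝ) →ₗ[ℝ] (ℝ × ℝ)) = ⊥ := LinearMap.ker_eq_bot.2 hinj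
  have hsurj : Function.Surjective (M : (ℝ × ℝ) →ₗ[ℝ] (ℝ × ℝ)) := LinearMap.injective_iff_surjective.1 hinj
  have hrange : LinearMap.range (M : (ℝ × ℝ) →ₗ[ℝ] (ℝ × ℝ)) = ⊤ := LinearMap.range_eq_top.2 hsurj
  have hEM : (ContinuousLinearEquiv.ofBijective M hker hrange : (ℝ × ℝ) →L[ℝ] (ℝ × ℝ)) = M :=
    ContinuousLinearEquiv.coe_ofBijective M hker hrange
  refine ⟨ContinuousLinearEquiv.ofBijective M hker hrange, fun v => ?_, ?_⟩
  · show (ContinuousLinearEquiv.ofBijective M hker hrange : (ℝ × ℝ) →L[ℝ] (ℝ × ℝ)) v = _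
    rw [hEM, hM]
    rfl
  · have hΘ := hasStrictFDerivAt_logTilt t1 t2 t3
    rw [← hM, ← hEM] at hΘ
    have hg := continuousAt_densityMap A B
    exact HasStrictFDerivAt.of_local_left_inverse hg hΘ (Filter.Eventually.of_forall fun q => logTilt_densityMap q)

/-! ## §3 The entries of the susceptibility matrix: signs and the Maxwell relation -/

/-- ★★ **`det M > 0`** on the open triangle (`M` symmetric positive definite): with `m₁₁ = 4/ρ+8/P+2/Q−1/a`, `m₁₂ = 4/ρ+4/P+4/Q`,
`m₂₂ = 4/ρ+2/P+8/Q−1/a'`: `m₁₁ > 0` and `m₁₁m₂₂ − m₁₂² > 0`. [cite: DemboZeitouni2010, §2.2 (lane statement)] -/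
theorem logTiltDeriv_det_pos {a a' : ℝ} (h1 : a + a' < 1 / 2) (h2 : 1 < 4 * a + 2 * a') (h3 : 1 < 2 * a + 4 * a') :
    0 < 4 / (1 - 2 * a - 2 * a') + 8 / (4 * a + 2 * a' - 1) + 2 / (2 * a + 4 * a' - 1) - 1 / a ∧
    0 < (4 / (1 - 2 * a - 2 * a') + 8 / (4 * a + 2 * a' - 1) + 2 / (2 * a + 4 * a' - 1) - 1 / a) *
          (4 / (1 - 2 * a - 2 * a') + 2 / (4 * a + 2 * a' - 1) + 8 / (2 * a + 4 * a' - 1) - 1 / a') -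
        (4 / (1 - 2 * a - 2 * a') + 4 / (4 * a + 2 * a' - 1) + 4 / (2 * a + 4 * a' - 1)) ^ 2 := by
  have hm : 0 < 4 / (1 - 2 * a - 2 * a') + 8 / (4 * a + 2 * a' - 1) + 2 / (2 * a + 4 * a' - 1) - 1 / a := by
    have h := curvatureForm_pos h1 h2 h3 (v₁ := 1) (v₂ := 0) (by simp)
    have e : 4 * ((1 : ℝ) + 0) ^ 2 / (1 - 2 * a - 2 * a') + 2 * (2 * 1 + 0) ^ 2 / (4 * a + 2 * a' - 1)
        + 2 * (1 + 2 * 0) ^ 2 / (2 * a + 4 * a' - 1) - 1 ^ 2 / a - 0 ^ 2 / a' =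
        4 / (1 - 2 * a - 2 * a') + 8 / (4 * a + 2 * a' - 1) + 2 / (2 * a + 4 * a' - 1) - 1 / a := by ring
    rw [e] at h; exact h
  refine ⟨hm, ?_⟩
  set m₁₁ := 4 / (1 - 2 * a - 2 * a') + 8 / (4 * a + 2 * a' - 1) + 2 / (2 * a + 4 * a' - 1) - 1 / a with hm11
  set m₁₂ := 4 / (1 - 2 * a - 2 * a') + 4 / (4 * a + 2 * a' - 1) + 4 / (2 * a + 4 * a' - 1) with hm12
  set m₂₂ := 4 / (1 - 2 * a - 2 * a') + 2 / (4 * a + 2 * a' - 1) + 8 / (2 * a + 4 * a' - 1) - 1 / a' with hm22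
  have hv : ((m₁₂, -m₁₁) : ℝ × ℝ) ≠ (0, 0) := by
    intro h; have := (Prod.mk.inj h).2; linarith
  have h := curvatureForm_pos h1 h2 h3 (v₁ := m₁₂) (v₂ := -m₁₁) hv
  have e : 4 * (m₁₂ + -m₁₁) ^ 2 / (1 - 2 * a - 2 * a') + 2 * (2 * m₁₂ + -m₁₁) ^ 2 / (4 * a + 2 * a' - 1)
      + 2 * (m₁₂ + 2 * -m₁₁) ^ 2 / (2 * a + 4 * a' - 1) - m₁₂ ^ 2 / a - (-m₁₁) ^ 2 / a' =
      m₁₁ * (m₁₁ * m₂₂ - m₁₂ ^ 2) := by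
    rw [hm11, hm12, hm22]; ring
  rw [e] at h
  exact (pos_iff_pos_of_mul_pos h).1 hm

/-- ★★★★ **THE SUSCEPTIBILITIES IN CLOSED FORM**: for all `A, B`, with `(b,b')` the typical pair of `(e^A, e^B)`, `m₁₁, m₁₂, m₂₂` the entries of
`M = −Hess s` at `(b,b')` and `D = m₁₁m₂₂ − m₁₂² > 0`:
`∂b/∂A = m₂₂/D > 0` (own-wall response), `∂b/∂B = −m₁₂/D < 0` (★ THE WALLS COMPETE: a more attractive top wall strictly lowers the bottom
contact density) and `∂b'/∂A = −m₁₂/D = ∂b/∂B` (the MAXWELL symmetry of the mixed responses) — all as genuine derivatives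
(`A = log y`, `B = log z`). [cite: DemboZeitouni2010, §2.2 (lane statement); JansevanRensburg2000, §3.3 (1st ed.)] -/
theorem hasDerivAt_contactB_log (A B : ℝ) :
    let b := contactB (Real.exp A) (Real.exp B)
    let b' := contactB (Real.exp B) (Real.exp A)
    let m₁₁ := 4 / (1 - 2 * b - 2 * b') + 8 / (4 * b + 2 * b' - 1) + 2 / (2 * b + 4 * b' - 1) - 1 / b
    let m₁₂ := 4 / (1 - 2 * b - 2 * b') + 4 / (4 * b + 2 * b' - 1) + 4 / (2 * b + 4 * b' - 1)
    let m₂₂ := 4 / (1 - 2 * b - 2 * b') + 2 / (4 * b + 2 * b' - 1) + 8 / (2 * b + 4 * b' - 1) - 1 / b'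
    0 < m₁₁ * m₂₂ - m₁₂ ^ 2 ∧ 0 < m₁₂ ∧
      HasDerivAt (fun t => contactB (Real.exp t) (Real.exp B)) (m₂₂ / (m₁₁ * m₂₂ - m₁₂ ^ 2)) A ∧
      HasDerivAt (fun t => contactB (Real.exp A) (Real.exp t)) (-m₁₂ / (m₁₁ * m₂₂ - m₁₂ ^ 2)) B ∧
      HasDerivAt (fun t => contactB (Real.exp B) (Real.exp t)) (-m₁₂ / (m₁₁ * m₂₂ - m₁₂ ^ 2)) A ∧
      0 < m₂₂ / (m₁₁ * m₂₂ - m₁₂ ^ 2) ∧ -m₁₂ / (m₁₁ * m₂₂ - m₁₂ ^ 2) < 0 := by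
  intro b b' m₁₁ m₁₂ m₂₂
  obtain ⟨t1, t2, t3⟩ := contactB_mem_triangle (Real.exp_pos A) (Real.exp_pos B)
  obtain ⟨hm11, hdet⟩ := logTiltDeriv_det_pos t1 t2 t3
  have hρ : (0 : ℝ) < 1 - 2 * b - 2 * b' := by show (0:ℝ) < 1 - 2 * contactB _ _ - 2 * contactB _ _; linarith
  have hP : (0 : ℝ) < 4 * b + 2 * b' - 1 := by show (0:ℝ) < 4 * contactB _ _ + 2 * contactB _ _ - 1; linarith
  have hQ : (0 : ℝ) < 2 * b + 4 * b' - 1 := by show (0:ℝ) < 2 * contactB _ _ + 4 * contactB _ _ - 1; linarith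
  have hm12 : 0 < m₁₂ := by show 0 < 4 / (1 - 2 * b - 2 * b') + 4 / (4 * b + 2 * b' - 1) + 4 / (2 * b + 4 * b' - 1); positivity
  have hm22 : 0 < m₂₂ := by
    -- by symmetry (the `(0,1)` direction of the curvature form)
    have h := curvatureForm_pos t1 t2 t3 (v₁ := 0) (v₂ := 1) (by simp)
    have e : 4 * ((0 : ℝ) + 1) ^ 2 / (1 - 2 * b - 2 * b') + 2 * (2 * 0 + 1) ^ 2 / (4 * b + 2 * b' - 1)
        + 2 * (0 + 2 * 1) ^ 2 / (2 * b + 4 * b' - 1) - 0 ^ 2 / b - 1 ^ 2 / b' = m₂₂ := by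
      show _ = 4 / (1 - 2 * b - 2 * b') + 2 / (4 * b + 2 * b' - 1) + 8 / (2 * b + 4 * b' - 1) - 1 / b'; ring
    rw [e] at h; exact h
  set D := m₁₁ * m₂₂ - m₁₂ ^ 2 with hD
  have hD0 : 0 < D := hdet
  obtain ⟨E, hE, hg⟩ := hasStrictFDerivAt_densityMap A B
  -- the two columns of `E⁻¹`
  have col1 : E.symm (1, 0) = (m₂₂ / D, -m₁₂ / D) := by
    have h := hE (m₂₂ / D, -m₁₂ / D)
    have e : E (m₂₂ / D, -m₁₂ / D) = (1, 0) := by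
      rw [h]
      refine Prod.ext ?_ ?_
      · show m₁₁ * (m₂₂ / D) + m₁₂ * (-m₁₂ / D) = 1
        field_simp; rw [hD]; ring
      · show m₁₂ * (m₂₂ / D) + m₂₂ * (-m₁₂ / D) = 0
        field_simp; ring
    rw [← e, ContinuousLinearEquiv.symm_apply_apply]
  have col2 : E.symm (0, 1) = (-m₁₂ / D, m₁₁ / D) := by
    have h := hE (-m₁₂ / D, m₁₁ / D)
    have e : E (-m₁₂ / D, m₁₁ / D) = (0, 1) := by
      rw [h]
      refine Prod.ext ?_ ?_
      · show m₁₁ * (-m₁₂ / D) + m₁₂ * (m₁₁ / D) = 0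
        field_simp; ring
      · show m₁₂ * (-m₁₂ / D) + m₂₂ * (m₁₁ / D) = 1
        field_simp; rw [hD]; ring
    rw [← e, ContinuousLinearEquiv.symm_apply_apply]
  have hgf := hg.hasFDerivAt
  -- restrict to the two coordinate lines
  have cA : HasDerivAt (fun t : ℝ => ((t, B) : ℝ × ℝ)) ((1, 0) : ℝ × ℝ) A := by
    have := (hasDerivAt_id A).prodMk (hasDerivAt_const A B)
    simpa using this
  have cB : HasDerivAt (fun t : ℝ => ((A, t) : ℝ × ℝ)) ((0, 1) : ℝ × ℝ) B := by
    have := (hasDerivAt_const B A).prodMk (hasDerivAt_id B)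
    simpa using this
  have dA := hgf.comp_hasDerivAt A cA
  have dB := hgf.comp_hasDerivAt B cB
  rw [ContinuousLinearEquiv.coe_coe, col1] at dA
  rw [ContinuousLinearEquiv.coe_coe, col2] at dB
  have dA1 : HasDerivAt (fun t => contactB (Real.exp t) (Real.exp B)) (m₂₂ / D) A := by
    have := (hasFDerivAt_fst (𝕜 := ℝ) (E := ℝ) (F := ℝ)).comp_hasDerivAt A dA
    simp only [Function.comp_def] at this
    exact this
  have dA2 : HasDerivAt (fun t => contactB (Real.exp B) (Real.exp t)) (-m₁₂ / D) A := by
    have := (hasFDerivAt_snd (𝕜 := ℝ) (E := ℝ) (F := ℝ)).comp_hasDerivAt A dA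
    simp only [Function.comp_def] at this
    exact this
  have dB1 : HasDerivAt (fun t => contactB (Real.exp A) (Real.exp t)) (-m₁₂ / D) B := by
    have := (hasFDerivAt_fst (𝕜 := ℝ) (E := ℝ) (F := ℝ)).comp_hasDerivAt B dB
    simp only [Function.comp_def] at this
    exact this
  refine ⟨hD0, hm12, dA1, dB1, dA2, div_pos hm22 hD0, ?_⟩
  rw [neg_div]; exact neg_neg_of_pos (div_pos hm12 hD0)

/-! ## §4 The free energy is `C²` in the log-fugacities -/

/-- ★★★ **THE FREE ENERGY IS `C²`, WITH EXPLICIT SECOND DERIVATIVES**: for all `A, B`, the partial derivative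
`∂/∂A log μ₁(e^A, e^B) = b(e^A,e^B)` (the tree's `hasDerivAt_log_stripMuY₂_exp`) is itself differentiable:
`∂²/∂A² log μ₁(e^A,e^B) = m₂₂/D > 0` and `∂²/∂B∂A log μ₁(e^A,e^B) = −m₁₂/D < 0` at the typical pair (`m`, `D` as in `hasDerivAt_contactB_log`):
the Hessian of the free energy in `(log y, log z)` is `M⁻¹`. [cite: DemboZeitouni2010, §2.2 (Λ is smooth with Hessian the covariance / inverse of the rate's Hessian; lane statement); JansevanRensburg2000, §3.3 (1st ed.)] -/
theorem hasDerivAt_deriv_log_stripMuY₂_exp₂ (A B : ℝ) :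
    let b := contactB (Real.exp A) (Real.exp B)
    let b' := contactB (Real.exp B) (Real.exp A)
    let m₁₁ := 4 / (1 - 2 * b - 2 * b') + 8 / (4 * b + 2 * b' - 1) + 2 / (2 * b + 4 * b' - 1) - 1 / b
    let m₁₂ := 4 / (1 - 2 * b - 2 * b') + 4 / (4 * b + 2 * b' - 1) + 4 / (2 * b + 4 * b' - 1)
    let m₂₂ := 4 / (1 - 2 * b - 2 * b') + 2 / (4 * b + 2 * b' - 1) + 8 / (2 * b + 4 * b' - 1) - 1 / b'
    HasDerivAt (fun t => deriv (fun s => Real.log (stripMuY₂ 1 (Real.exp s) (Real.exp B))) t) (m₂₂ / (m₁₁ * m₂₂ - m₁₂ ^ 2)) A ∧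
    HasDerivAt (fun t => deriv (fun s => Real.log (stripMuY₂ 1 (Real.exp s) (Real.exp t))) A) (-m₁₂ / (m₁₁ * m₂₂ - m₁₂ ^ 2)) B := by
  intro b b' m₁₁ m₁₂ m₂₂
  obtain ⟨-, -, dA1, dB1, -, -, -⟩ := hasDerivAt_contactB_log A B
  have e1 : (fun t => deriv (fun s => Real.log (stripMuY₂ 1 (Real.exp s) (Real.exp B))) t) =
      fun t => contactB (Real.exp t) (Real.exp B) := by
    funext t; exact (hasDerivAt_log_stripMuY₂_exp (Real.exp_pos B) t).deriv
  have e2 : (fun t => deriv (fun s => Real.log (stripMuY₂ 1 (Real.exp s) (Real.exp t))) A) =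
      fun t => contactB (Real.exp A) (Real.exp t) := by
    funext t; exact (hasDerivAt_log_stripMuY₂_exp (Real.exp_pos t) A).deriv
  rw [e1, e2]
  exact ⟨dA1, dB1⟩

end Literature.Probability.RandomPlanarGeometry.SAW.HexBW
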